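import Mathlib
import Summits.KontsevichZagierPeriods.KontsevichZagierPeriods.Theorems.SoloInformedNashCubulation
import HarnessLib
import HarnessLib.Audit

/-!
# SoloInformed — the non-motivic residue of the period conjecture is a zero-divisor question

The landed Ayoub transfer (`soloInformed_ayoubTransfer₈`) uses Ayoub's form of the period
conjecture in the EFFECTIVE shape `SoloInformedAyoubKZeffQ` (injectivity, up to torsion, of
`Ev : 𝒫^eff_ℝ → ℂ`). Ayoub's printed statement is on the LOCALISATION: `𝒫 := 𝒫^eff[(2πi)⁻¹]`
[Ayoub 2014, Def. 10], `𝒫 ≃ 𝒫_KZ` [Ayoub 2014, Prop. 11], and "the evaluation homomorphism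
`Ev : 𝒫 → ℂ` is injective" ⟺ Kontsevich–Zagier [Ayoub 2014, Rem. 13]; here
`𝒫_KZ = 𝒫^eff_KZ[(2πi)⁻¹]` [Ayoub 2014, Def. 6] is the algebra of formal periods of all Nori
motives over `ℚ` [Huber–Müller-Stach, Def. 12.1.1, Thm. 12.1.3], on which the injectivity of the
evaluation follows from the Grothendieck period conjecture for every Nori motive
[Huber–Müller-Stach, Conj. 12.2.1, Conj. 12.2.5, Lemma 12.2.6].

This file isolates what separates the localised (motivic) statement from the summit:

* `SoloInformedKZSat` — **saturation**: in the formal period ring `P = FormalRep ⧸ relations` of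
  the KZ calculus, an element of non-zero period is a non-zero-divisor; and the stronger
  `SoloInformedKZDomain` — `P` is an integral domain. Both follow from the summit
  (`soloInformed_kzSat_of_kzp`, `soloInformed_kzDomain_of_kzp`: under the period conjecture
  `evalP : P → ℝ` is injective).
* `SoloInformedAyoubKZLoc` — **Ayoub's conjecture, localised form, read on the KZ side**: a real
  Ayoub symbol `x` with `Ev x = 0` is, after the transfer `Ψ`, killed by some formal combination
  of non-zero period: `∃ u, eval u ≠ 0 ∧ u · Ψ x ∈ relations`. It is implied by the effective form
  (`soloInformed_ayoubKZLoc_of_KZeffQ`, with `u = N · [pt, 1]`), and — this is the point, argued in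
  the accompanying paper, not in Lean — by the Grothendieck period conjecture for Nori motives:
  `Ev x = 0` ⟹ `x = 0` in `𝒫 ≃ 𝒫_KZ` ⟹ `(2πi)^N · x = 0` in `𝒫^eff` ⟹ (applying the ring map
  `Ψ ⊗ ℤ[i]` and clearing denominators) `u · Ψ x ∈ relations` with `eval u + i eval v =
  k (2πi)^N ≠ 0`.
* `soloInformed_ayoubTransferLoc₈ : SoloInformedSeparationOfPoles → SoloInformedNashCubulation →
  SoloInformedAyoubKZLoc → SoloInformedKZSat → KontsevichZagierPeriods` — the transfer with the
  localised hypothesis: saturation is exactly what is needed to cancel the element of non-zero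
  period.

Net effect (paper, Theorem B′): granted separation of poles [Viu-Sos 2021, Cor. 2.2] and Nash
cubulation, `KontsevichZagierPeriods ⟺ GPC(Nori, ∀ M) ∧ SoloInformedKZSat`, and one may replace
`SoloInformedKZSat` by `SoloInformedKZDomain`.

References: J. Ayoub, *Periods and the conjectures of Grothendieck and Kontsevich–Zagier*, EMS
Newsl. 91 (2014) 12–18, Def. 6, Def. 9–10, Prop. 11, Rem. 12–13; A. Huber, S. Müller-Stach,
*On the relation between Nori motives and Kontsevich periods* (notes, 2011) / *Periods and Nori
motives* (Springer, 2017), Def. 12.1.1, Thm. 12.1.3, Conj. 12.2.1, Conj. 12.2.5, Lemma 12.2.6;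
M. Kontsevich, D. Zagier, *Periods* (2001), §1.2, §4.1.
-/

noncomputable section

open scoped BigOperators
open Set MeasureTheory
open Literature.NumberTheory.Transcendental Literature.NumberTheory.Transcendental.KZ

namespace Summit.KontsevichZagierPeriods.KontsevichZagierPeriods.Theorems

/-! ### Saturation and integrality of the formal period ring -/

/-- **Integrality of the formal period ring**: `P = FormalRep ⧸ relations` has no zero-divisors.
A consequence of the period conjecture (`soloInformed_kzDomain_of_kzp`); OPEN on its own.
[Kontsevich–Zagier 2001, §1.2, §4.1] -/
@[conjecture] def SoloInformedKZDomain : Prop :=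
  ∀ p q : FormalPeriodRing, p * q = 0 → p = 0 ∨ q = 0

/-- **Saturation of the formal period ring at elements of non-zero period**: if `evalP p ≠ 0`
then `p` is a non-zero-divisor of `P`. Equivalently: whenever `[σ, f] · [τ, g]` is a combination
of moves and `∫_σ f ≠ 0`, already `[τ, g]` is a combination of moves. A consequence of the period
conjecture (`soloInformed_kzSat_of_kzp`); OPEN on its own. [Kontsevich–Zagier 2001, §1.2, §4.1] -/
@[conjecture] def SoloInformedKZSat : Prop :=
  ∀ p q : FormalPeriodRing, evalP p ≠ 0 → p * q = 0 → q = 0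

/-- Integrality implies saturation. -/
theorem soloInformed_kzSat_of_kzDomain (h : SoloInformedKZDomain) : SoloInformedKZSat :=
  fun p q hp hpq => (h p q hpq).resolve_left fun h0 => hp (by rw [h0, map_zero])

/-- **Under the period conjecture `evalP : P → ℝ` is injective.**
[Kontsevich–Zagier 2001, §1.2 Conjecture 1] -/
theorem soloInformed_evalP_injective_of_kzp (h : KontsevichZagierPeriods) :
    Function.Injective evalP := by
  have hK : KZKernelConjecture :=
    kzKernelConjecture_iff_isRational.2 (KontsevichZagierPeriods_iff.1 h)
  intro p q hpq
  obtain ⟨c, rfl⟩ := toFormalPeriod_surjective p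
  obtain ⟨d, rfl⟩ := toFormalPeriod_surjective q
  rw [toFormalPeriod_eq_iff]
  apply hK
  rw [evalP_toFormalPeriod, evalP_toFormalPeriod] at hpq
  rw [map_sub, hpq, sub_self]

/-- **The period conjecture implies integrality of the formal period ring.** -/
theorem soloInformed_kzDomain_of_kzp (h : KontsevichZagierPeriods) : SoloInformedKZDomain := by
  intro p q hpq
  have hi := soloInformed_evalP_injective_of_kzp h
  have h0 : evalP p * evalP q = 0 := by rw [← map_mul, hpq, map_zero]
  rcases mul_eq_zero.1 h0 with hp | hq
  · exact Or.inl (hi (by rw [hp, map_zero]))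
  · exact Or.inr (hi (by rw [hq, map_zero]))

/-- **The period conjecture implies saturation of the formal period ring.** -/
theorem soloInformed_kzSat_of_kzp (h : KontsevichZagierPeriods) : SoloInformedKZSat :=
  soloInformed_kzSat_of_kzDomain (soloInformed_kzDomain_of_kzp h)

/-! ### Ayoub's conjecture in localised form, read through `Ψ` -/

/-- **Ayoub's form of the period conjecture, LOCALISED shape, read on the KZ side.** For every
real Ayoub symbol `x` with `Ev x = 0`, the transferred combination `Ψ x` of cube integrals is
killed, modulo the KZ moves, by a formal combination `u` of NON-ZERO period:
`u · Ψ x ∈ relations`. This is the faithful KZ-side reading of injectivity of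
`Ev : 𝒫 = 𝒫^eff[(2πi)⁻¹] → ℂ` [Ayoub 2014, Def. 10, Rem. 13] (`x ↦ 0` in the localisation iff
`(2πi)^N x = 0` in `𝒫^eff`; push forward by the ring map `Ψ ⊗ ℤ[i]`, clear denominators, and
keep a component of `k (2πi)^N` with non-zero period), hence — by [Ayoub 2014, Prop. 11] and
[Huber–Müller-Stach, Def. 12.1.1, Lemma 12.2.6] — a consequence of the Grothendieck period
conjecture for all Nori motives over `ℚ` (paper-level deduction). Implied by the effective shape
`SoloInformedAyoubKZeffQ` (`soloInformed_ayoubKZLoc_of_KZeffQ`). OPEN; used only as an explicit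
hypothesis. [cite: Ayoub2014, Def. 10, Prop. 11, Rem. 13] -/
@[conjecture] def SoloInformedAyoubKZLoc : Prop :=
  ∀ x : SoloInformedAyoubSymbols, soloInformedAyoubEv x = 0 →
    ∃ u : FormalRep, eval u ≠ 0 ∧ u * soloInformedAyoubPsi soloInformed_ayoubLemmaQ x ∈ relations

/-- The effective shape (up to torsion) implies the localised shape: take `u = N · [pt, 1]`. -/
theorem soloInformed_ayoubKZLoc_of_KZeffQ (h : SoloInformedAyoubKZeffQ) :
    SoloInformedAyoubKZLoc := by
  intro x hx
  obtain ⟨N, hN, hNx⟩ := h x hx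
  refine ⟨N • of IntegralRep.unit, ?_, ?_⟩
  · rw [map_nsmul, eval_of, IntegralRep.value_unit, nsmul_eq_mul, mul_one]
    exact_mod_cast hN
  · rw [← toFormalPeriod_eq_zero_iff, map_mul, map_nsmul, toFormalPeriod_of_unit, smul_mul_assoc,
      one_mul, ← map_nsmul, toFormalPeriod_eq_zero_iff, ← map_nsmul]
    exact soloInformedAyoubPsi_rel _ hNx

/-- The torsion-free effective shape implies the localised shape. -/
theorem soloInformed_ayoubKZLoc_of_KZeff (h : SoloInformedAyoubKZeff) : SoloInformedAyoubKZLoc :=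
  soloInformed_ayoubKZLoc_of_KZeffQ (soloInformed_ayoubKZeffQ_of_KZeff h)

/-! ### The transfer with the localised hypothesis -/

/-- **THEOREM D_A, localised form.** THEOREM P_A (presentation onto Ayoub generators), Ayoub's
conjecture in the localised shape and saturation of the formal period ring imply the
Kontsevich–Zagier period conjecture. Mechanism: as in `soloInformed_ayoubTransferQ`, equal values
give a real Ayoub symbol `y = k'•x − k•x'` with `Ev y = 0`; the localised hypothesis gives
`u · Ψ y ∈ relations` with `eval u ≠ 0`; saturation cancels `u`; FACT M cancels `k k'`.
[Ayoub 2014, Prop. 11, Rem. 13; Kontsevich–Zagier 2001, §1.2] -/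
theorem soloInformed_ayoubTransferLoc (hP : SoloInformedAyoubPresentation)
    (hA : SoloInformedAyoubKZLoc) (hS : SoloInformedKZSat) : KontsevichZagierPeriods := by
  refine KontsevichZagierPeriods_iff.2 fun n n' r r' _ _ hv => ?_
  obtain ⟨k, hk, m, d, a, c, ρ, hρd, hρi, hrel⟩ := hP n r
  obtain ⟨k', hk', m', d', a', c', ρ', hρd', hρi', hrel'⟩ := hP n' r'
  set x : SoloInformedAyoubSymbols := ∑ j, c j • soloInformedAyoubOf (a j) with hx
  set x' : SoloInformedAyoubSymbols := ∑ j, c' j • soloInformedAyoubOf (a' j) with hx'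
  have hψ : soloInformedAyoubPsi soloInformed_ayoubLemmaQ x - k • of r ∈ relations :=
    soloInformedAyoubPsi_presentation soloInformed_ayoubLemmaQ r a c ρ hρd hρi hrel
  have hψ' : soloInformedAyoubPsi soloInformed_ayoubLemmaQ x' - k' • of r' ∈ relations :=
    soloInformedAyoubPsi_presentation soloInformed_ayoubLemmaQ r' a' c' ρ' hρd' hρi' hrel'
  have hre := soloInformedAyoubEv_re_eq soloInformed_ayoubLemmaQ r k x hψ
  have hre' := soloInformedAyoubEv_re_eq soloInformed_ayoubLemmaQ r' k' x' hψ'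
  have him : (soloInformedAyoubEv x).im = 0 :=
    soloInformedAyoubEv_sum_im soloInformed_ayoubLemmaQ a c
  have him' : (soloInformedAyoubEv x').im = 0 :=
    soloInformedAyoubEv_sum_im soloInformed_ayoubLemmaQ a' c'
  have hy : soloInformedAyoubEv (k' • x - k • x') = 0 := by
    apply Complex.ext
    · rw [map_sub, map_nsmul, map_nsmul, nsmul_eq_mul, nsmul_eq_mul, Complex.sub_re,
        Complex.mul_re, Complex.mul_re, hre, hre', him, him', hv]
      simp only [Complex.natCast_re, Complex.natCast_im, zero_mul, sub_zero, Complex.zero_re]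
      ring
    · rw [map_sub, map_nsmul, map_nsmul, nsmul_eq_mul, nsmul_eq_mul, Complex.sub_im,
        Complex.mul_im, Complex.mul_im, hre, hre', him, him']
      simp
  -- Ayoub's conjecture, localised: `u · Ψ y` is a KZ relation for some `u` of non-zero period
  obtain ⟨u, hu, huy⟩ := hA _ hy
  have h1 : toFormalPeriod u *
      toFormalPeriod (soloInformedAyoubPsi soloInformed_ayoubLemmaQ (k' • x - k • x')) = 0 := by
    rw [← map_mul, toFormalPeriod_eq_zero_iff]
    exact huy
  -- saturation cancels `u`
  have hΨy : soloInformedAyoubPsi soloInformed_ayoubLemmaQ (k' • x - k • x') ∈ relations :=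
    toFormalPeriod_eq_zero_iff.1 (hS _ _ (by rwa [evalP_toFormalPeriod]) h1)
  -- hence `(k * k') • ([r] - [r'])` is a KZ relation, and FACT M removes the multiple
  have hkk : (k * k') • (of r - of r') ∈ relations := by
    have e : (k * k') • (of r - of r') =
        soloInformedAyoubPsi soloInformed_ayoubLemmaQ (k' • x - k • x') -
        k' • (soloInformedAyoubPsi soloInformed_ayoubLemmaQ x - k • of r) +
        k • (soloInformedAyoubPsi soloInformed_ayoubLemmaQ x' - k' • of r') := by
      rw [map_sub, map_nsmul, map_nsmul, smul_sub, smul_sub, smul_sub, ← mul_smul, ← mul_smul,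
        mul_comm k' k]
      abel
    rw [e]
    exact relations.add_mem (relations.sub_mem hΨy (relations.nsmul_mem hψ k'))
      (relations.nsmul_mem hψ' k)
  exact soloInformed_equivalent_of_nsmul_sub_mem (mul_ne_zero hk hk') hkk

/-- **The localised transfer from the radius-free resolution statement.** -/
theorem soloInformed_ayoubTransferLoc₄ (hR : SoloInformedAyoubCubeResolution)
    (hA : SoloInformedAyoubKZLoc) (hS : SoloInformedKZSat) : KontsevichZagierPeriods :=
  soloInformed_ayoubTransferLoc (soloInformed_presentation_of_cubeResolution hR) hA hS

/-- **The localised Ayoub transfer from Nash cubulation.** Separation of poles in dimension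
`≥ 2` [Viu-Sos 2021, Cor. 2.2], Nash cubulation of `ℚ`-semialgebraic sets, Ayoub's conjecture
in the localised shape [Ayoub 2014, Def. 10, Prop. 11, Rem. 13] and saturation of the formal
period ring imply the Kontsevich–Zagier period conjecture. Since the summit implies saturation
(`soloInformed_kzSat_of_kzp`) and — via "KZ moves are motivic" — the Grothendieck period
conjecture for Nori motives, which in turn implies the localised Ayoub statement, this exhibits
saturation as the exact non-motivic residue of the summit along this line. -/
theorem soloInformed_ayoubTransferLoc₈ (H₂ : SoloInformedSeparationOfPoles)
    (hN : SoloInformedNashCubulation) (hA : SoloInformedAyoubKZLoc) (hS : SoloInformedKZSat) :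
    KontsevichZagierPeriods :=
  soloInformed_ayoubTransferLoc₄
    (soloInformed_cubeResolution_of_volumes H₂ (soloInformed_volumeResolution_of_cube
      (soloInformed_cubeVolumeResolution_of_nashCubulation hN))) hA hS

/-- The same with integrality of the formal period ring in place of saturation. -/
theorem soloInformed_ayoubTransferDom₈ (H₂ : SoloInformedSeparationOfPoles)
    (hN : SoloInformedNashCubulation) (hA : SoloInformedAyoubKZLoc) (hD : SoloInformedKZDomain) :
    KontsevichZagierPeriods :=
  soloInformed_ayoubTransferLoc₈ H₂ hN hA (soloInformed_kzSat_of_kzDomain hD)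

/-- **Sandwich, kernel-checked half.** Granted separation of poles, Nash cubulation and Ayoub's
localised statement (the motivic input), the summit is EQUIVALENT to saturation of the formal
period ring, and to its integrality. -/
theorem soloInformed_kzp_iff_kzSat (H₂ : SoloInformedSeparationOfPoles)
    (hN : SoloInformedNashCubulation) (hA : SoloInformedAyoubKZLoc) :
    (KontsevichZagierPeriods ↔ SoloInformedKZSat) ∧
      (KontsevichZagierPeriods ↔ SoloInformedKZDomain) :=
  ⟨⟨soloInformed_kzSat_of_kzp, soloInformed_ayoubTransferLoc₈ H₂ hN hA⟩,
    ⟨soloInformed_kzDomain_of_kzp, soloInformed_ayoubTransferDom₈ H₂ hN hA⟩⟩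

end Summit.KontsevichZagierPeriods.KontsevichZagierPeriods.Theorems
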